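import Literature.Analysis.FluidPDE.FractionalNSPrescribedEnergyProlongationProofs
import HarnessLib

/-!
# Energy profiles for De Rosa's non-uniqueness theorem (De Rosa 2019, §2, proof of Thm. 1.2):
  the explicit profile family, the energy inequality from a prescribed energy, restriction to
  shorter slabs

Analysis/FluidPDE proof file, definition-free; third sibling of `FractionalNSPrescribedEnergy`
(after `FractionalNSPrescribedEnergyProofs`, which discharges Cor. 7.2, and
`FractionalNSPrescribedEnergyProlongationProofs`, which proves the gluing/prolongation). It supplies
the elementary real-analysis and measure-theory content of De Rosa's proof of his Thm. 1.2 (§2, p. 5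
of the held arXiv text 1801.10235): "Elementary arguments produce for every `K > 1` an infinite set
`𝓔_K` of smooth functions `e : [0,1] → ℝ` with (i) `½ ≤ e(t) ≤ 1`; (ii) `‖e‖_{C¹} ≤ 2K+2`;
(iii) `e(0) = 1`; (iv) `e'(t) ≤ -2K+2 ∀ t ∈ [0, 1/4K]`; (v) for any pair of distinct elements of
`𝓔_K` there is a sequence of times converging to `0` where they take different values", and "we
have to show that all these solutions strictly dissipate the total energy, which is equivalent to
`½(e(s) - e(t)) > ∫ₛᵗ∫|(-Δ)^{γ/2}v|²  ∀ 0 ≤ s < t ≤ T`". The assembly of Thm. 1.2 from these and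
the named facts of `FractionalNSPrescribedEnergy` is
`Literature/Barriers/NavierStokesRegularity/HypodissipativeLerayNonuniquenessDeRosaProofs`.

## Contents (all proved)

* `Torus.IsWeakFracNSSolutionOn.of_le` — distributional solutions on `T^d × (0,T)` restrict to
  `(0,T')`, `T' ≤ T`; `HolderOnSpaceTime.mono_time` — the space–time Hölder class restricts.
* The explicit profile family, in the normalised window of `DeRosa2019_thm21` (profiles
  `c₀/2 ≤ e ≤ c₀`, `|e'| ≤ c₀K/T₀` on `[0,T₀]`): `e(t) = c₀(1 - 2μT(1 - exp(-t/2T)))` — written out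
  in full in every statement (no definition is introduced) — its derivative `-c₀μe^{-t/2T}`,
  smoothness, `e(0) = c₀`, admissibility `isEnergyProfile_deRosaProfile` ((i)–(ii) for
  `0 ≤ μ ≤ K/T₀`, `2μT ≤ ½`), the drop `e(s) - e(t) ≥ ½c₀μ(t-s)` on `s ≤ t ≤ T` ((iv), integrated;
  from `eˣ ≥ 1 + x`), and injectivity of `μ ↦ e(T)` ((v) at the single time `T`).
* `eFracDissipation_le_of_cor72` — under Cor. 7.2, a slice with `‖f‖_∞ + [f]_r ≤ B` dissipates at
  most `C₇B²`; `fracEnergyIneq_of_profile` — the energy inequality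
  `½∫|v(t)|² + ∫ₛᵗ∫|(-Δ)^{α/2}v|² ≤ ½∫|v(s)|²` on `[0,T]` from `∫‖v t‖² = e t`, a dissipation bound `D`
  per unit time and a drop `e(s) - e(t) ≥ 2D(t-s)` (energies in `[0,∞]` as in `FractionalNSTorus`).

## References

* L. De Rosa, *Infinitely many Leray–Hopf solutions for the fractional Navier–Stokes equations*,
  Comm. PDE 44 (2019), 335–365 = arXiv:1801.10235, §2 (proof of Thm. 1.2, p. 5). [`Derosa2018`]
-/

noncomputable section

open MeasureTheory Set Filter Topology Function
open scoped ENNReal NNReal InnerProductSpace ContDiff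

/-! ## Restriction of slab notions to a shorter slab (general dimension) -/

namespace Literature.Analysis.FluidPDE.Torus

variable {d : Type*} [Fintype d] [DecidableEq d]

/-- **Distributional solutions restrict to shorter time intervals**: a weak solution of the
fractional system on `T^d × (0,T)` is one on `T^d × (0,T')` for `T' ≤ T` (test fields supported
in `(0,T')` are supported in `(0,T)`, and the weak-form integrand vanishes on `[T', T)` where the
test field and its time derivative vanish). [folklore] -/
theorem IsWeakFracNSSolutionOn.of_le {T T' α ν : ℝ} {u : ℝ → UnitAddTorus d → EuclideanSpace ℝ d}
    (h : IsWeakFracNSSolutionOn T α ν u) (hle : T' ≤ T) : IsWeakFracNSSolutionOn T' α ν u := by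
  obtain ⟨hm, hL2, hdiv, hweak⟩ := h
  have hsub : Ioo (0 : ℝ) T' ⊆ Ioo 0 T := Ioo_subset_Ioo_right hle
  refine ⟨hm.mono_measure (Measure.restrict_mono (prod_mono hsub subset_rfl) le_rfl),
    (lintegral_mono_set hsub).trans_lt hL2, ae_restrict_of_ae_restrict_of_subset hsub hdiv,
    fun ψ hψ hdivψ => ?_⟩
  obtain ⟨⟨hs, T'', hT'', h0⟩, ε, hε, hε0⟩ := hψ
  have hψT : FunctionSpaces.Torus.IsSpaceTimeTestIoo T ψ := ⟨⟨hs, T'', hT''.trans_le hle, h0⟩, ε, hε, hε0⟩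
  have hid := hweak ψ hψT hdivψ
  rw [setIntegral_eq_of_subset_of_forall_sdiff_eq_zero measurableSet_Ioo hsub] at hid
  · exact hid
  · intro t ht
    have htT' : T' ≤ t := by
      by_contra hlt
      exact ht.2 ⟨ht.1.1, not_le.1 hlt⟩
    obtain ⟨-, T₃, hT₃, hd0⟩ :=
      (show FunctionSpaces.Torus.IsSpaceTimeTest T' ψ from ⟨hs, T'', hT'', h0⟩).timeDeriv
    have h1 : ψ t = 0 := h0 t (hT''.le.trans htT')
    have h2 : FunctionSpaces.Torus.timeDeriv ψ t = 0 := hd0 t (hT₃.le.trans htT')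
    have h3 : ∀ x, FunctionSpaces.Torus.timeDeriv ψ t x = 0 := fun x => by rw [h2]; rfl
    simp [h1, h3, convect_pi_zero_right, fracLaplacian_zero_fun]

end Literature.Analysis.FluidPDE.Torus

namespace Literature.Analysis.FluidPDE

/-- Space–time Hölder continuity on `[0,T] × X` restricts to `[0,T'] × X` for `T' ≤ T`
(dot-notation extension of `Literature.Analysis.FunctionSpaces.HolderOnSpaceTime` of
`FunctionSpaces/HolderNorm`, declared with its absolute name). [folklore] -/
theorem _root_.Literature.Analysis.FunctionSpaces.HolderOnSpaceTime.mono_time {X Y : Type*}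
    [PseudoEMetricSpace X] [NormedAddCommGroup Y] {r : ℝ≥0} {T T' : ℝ} {u : ℝ → X → Y}
    (h : FunctionSpaces.HolderOnSpaceTime r T u) (hle : T' ≤ T) :
    FunctionSpaces.HolderOnSpaceTime r T' u := by
  obtain ⟨C, hC⟩ := h
  exact ⟨C, hC.mono (prod_mono (Icc_subset_Icc_right hle) subset_rfl)⟩

/-! ## The family of energy profiles `e(t) = c₀(1 - 2μT(1 - exp(-t/2T)))` -/

section Profiles

/-- Derivative of the profile: `e'(t) = -c₀ μ exp(-t/2T)`. [folklore] -/
theorem hasDerivAt_deRosaProfile (c₀ μ T t : ℝ) (hT : T ≠ 0) :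
    HasDerivAt (fun t => c₀ * (1 - 2 * μ * T * (1 - Real.exp (-t / (2 * T)))))
      (-(c₀ * μ * Real.exp (-t / (2 * T)))) t := by
  have h1 : HasDerivAt (fun t : ℝ => -t / (2 * T)) (-1 / (2 * T)) t := by
    simpa using ((hasDerivAt_id t).neg.div_const (2 * T))
  have h2 := ((((h1.exp).const_sub 1).const_mul (2 * μ * T)).const_sub 1).const_mul c₀
  refine h2.congr_deriv ?_
  rw [show c₀ * -(2 * μ * T * -(Real.exp (-t / (2 * T)) * (-1 / (2 * T)))) =
      -(c₀ * μ * Real.exp (-t / (2 * T))) * ((2 * T) / (2 * T)) by ring,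
    div_self (mul_ne_zero two_ne_zero hT), mul_one]

/-- The profile is smooth. [folklore] -/
theorem contDiff_deRosaProfile (c₀ μ T : ℝ) :
    ContDiff ℝ ∞ (fun t => c₀ * (1 - 2 * μ * T * (1 - Real.exp (-t / (2 * T))))) := by
  have h1 : ContDiff ℝ ∞ (fun t : ℝ => -t / (2 * T)) := contDiff_neg.div_const _
  exact contDiff_const.mul (contDiff_const.sub (contDiff_const.mul
    (contDiff_const.sub (Real.contDiff_exp.comp h1))))

/-- `deriv e t = -c₀ μ exp(-t/2T)`. [folklore] -/
theorem deriv_deRosaProfile (c₀ μ T t : ℝ) (hT : T ≠ 0) :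
    deriv (fun t => c₀ * (1 - 2 * μ * T * (1 - Real.exp (-t / (2 * T))))) t =
      -(c₀ * μ * Real.exp (-t / (2 * T))) :=
  (hasDerivAt_deRosaProfile c₀ μ T t hT).deriv

/-- `e(0) = c₀`. [folklore] -/
theorem deRosaProfile_zero (c₀ μ T : ℝ) :
    (fun t => c₀ * (1 - 2 * μ * T * (1 - Real.exp (-t / (2 * T))))) 0 = c₀ := by
  simp

/-- For `t ≥ 0` and `T > 0`, `0 < exp(-t/2T) ≤ 1`. [folklore] -/
theorem exp_neg_div_le_one {t T : ℝ} (ht : 0 ≤ t) (hT : 0 < T) : Real.exp (-t / (2 * T)) ≤ 1 := by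
  rw [Real.exp_le_one_iff]
  exact div_nonpos_of_nonpos_of_nonneg (by linarith) (by linarith)

/-- **Admissibility** of the profile `e(t) = c₀(1 - 2μT(1 - exp(-t/2T)))` in the window of
`DeRosa2019_thm21`: for `c₀, T > 0`, `0 ≤ μ ≤ K/T₀` and `2μT ≤ 1/2`, it is smooth with
`c₀/2 ≤ e ≤ c₀` and `|e'| ≤ c₀K/T₀` on `[0,T₀]` (indeed on `[0,∞)`). (De Rosa's (i)–(ii).)
[cite: Derosa2018, §2 proof of Thm. 1.2, (i)–(ii)] -/
theorem isEnergyProfile_deRosaProfile {c₀ T₀ K μ T : ℝ} (hc₀ : 0 < c₀) (hT : 0 < T)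
    (hμ0 : 0 ≤ μ) (hμK : μ ≤ K / T₀) (hμT : 2 * μ * T ≤ 1 / 2) :
    Literature.Analysis.FluidPDE.IsEnergyProfile c₀ T₀ K
      (fun t => c₀ * (1 - 2 * μ * T * (1 - Real.exp (-t / (2 * T))))) where
  contDiff := contDiff_deRosaProfile c₀ μ T
  lower := fun t ht => by
    have hexp : 0 < Real.exp (-t / (2 * T)) := Real.exp_pos _
    have h1 : 1 - Real.exp (-t / (2 * T)) ≤ 1 := by linarith
    have h2 : 2 * μ * T * (1 - Real.exp (-t / (2 * T))) ≤ 1 / 2 :=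
      calc 2 * μ * T * (1 - Real.exp (-t / (2 * T))) ≤ 2 * μ * T * 1 := by
            exact mul_le_mul_of_nonneg_left h1 (by positivity)
        _ ≤ 1 / 2 := by linarith
    nlinarith
  upper := fun t ht => by
    have h1 : 0 ≤ 1 - Real.exp (-t / (2 * T)) := by linarith [exp_neg_div_le_one ht.1 hT]
    have h2 : 0 ≤ 2 * μ * T * (1 - Real.exp (-t / (2 * T))) := by positivity
    nlinarith
  abs_deriv_le := fun t ht => by
    rw [deriv_deRosaProfile c₀ μ T t hT.ne', abs_neg,
      abs_of_nonneg (by positivity : 0 ≤ c₀ * μ * Real.exp (-t / (2 * T)))]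
    calc c₀ * μ * Real.exp (-t / (2 * T)) ≤ c₀ * μ * 1 := by
          exact mul_le_mul_of_nonneg_left (exp_neg_div_le_one ht.1 hT) (by positivity)
      _ ≤ c₀ * (K / T₀) := by rw [mul_one]; exact mul_le_mul_of_nonneg_left hμK hc₀.le
      _ = c₀ * K / T₀ := (mul_div_assoc c₀ K T₀).symm

/-- **Steep initial decrease** (De Rosa's (iv), integrated): for `s ≤ t ≤ T` the profile drops
by at least `½ c₀ μ (t - s)` (from `e^x ≥ 1 + x`: `e^a - e^b ≥ e^b (a - b)` and
`e^{-t/2T} ≥ e^{-1/2} ≥ ½`). [cite: Derosa2018, §2 proof of Thm. 1.2, (iv)] -/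
theorem deRosaProfile_sub_ge {c₀ μ T s t : ℝ} (hc₀ : 0 ≤ c₀) (hμ0 : 0 ≤ μ) (hT : 0 < T)
    (hst : s ≤ t) (htT : t ≤ T) :
    c₀ * μ / 2 * (t - s) ≤
      (fun t => c₀ * (1 - 2 * μ * T * (1 - Real.exp (-t / (2 * T))))) s -
        (fun t => c₀ * (1 - 2 * μ * T * (1 - Real.exp (-t / (2 * T))))) t := by
  set a : ℝ := -s / (2 * T) with ha
  set b : ℝ := -t / (2 * T) with hb
  have hab : a - b = (t - s) / (2 * T) := by
    rw [ha, hb]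
    field_simp
    ring
  have hb_ge : -(1 / 2 : ℝ) ≤ b := by
    rw [hb, le_div_iff₀ (by positivity)]
    linarith
  have hexpb : 1 / 2 ≤ Real.exp b := by linarith [Real.add_one_le_exp b]
  -- `e^a - e^b ≥ e^b (a - b)`
  have hconv : Real.exp b * (a - b) ≤ Real.exp a - Real.exp b := by
    have h1 : (a - b) + 1 ≤ Real.exp (a - b) := Real.add_one_le_exp _
    have h2 : Real.exp b * ((a - b) + 1) ≤ Real.exp b * Real.exp (a - b) :=
      mul_le_mul_of_nonneg_left h1 (Real.exp_pos b).le
    rw [← Real.exp_add, add_sub_cancel] at h2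
    linarith
  have hdiff : (fun t => c₀ * (1 - 2 * μ * T * (1 - Real.exp (-t / (2 * T))))) s -
      (fun t => c₀ * (1 - 2 * μ * T * (1 - Real.exp (-t / (2 * T))))) t =
        2 * c₀ * μ * T * (Real.exp a - Real.exp b) := by
    simp only [ha, hb]
    ring
  rw [hdiff]
  have hts : 0 ≤ t - s := by linarith
  calc c₀ * μ / 2 * (t - s) = 2 * c₀ * μ * T * ((1 / 2) * ((t - s) / (2 * T))) := by
        field_simp
    _ ≤ 2 * c₀ * μ * T * (Real.exp b * (a - b)) := by
        rw [hab]
        refine mul_le_mul_of_nonneg_left ?_ (by positivity)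
        exact mul_le_mul_of_nonneg_right hexpb (by positivity)
    _ ≤ 2 * c₀ * μ * T * (Real.exp a - Real.exp b) :=
        mul_le_mul_of_nonneg_left hconv (by positivity)

/-- The value at time `T` determines `μ` (for `c₀, T ≠ 0`): distinct slopes give distinct values
at `T` (De Rosa's (v), at the single time `T`). [cite: Derosa2018, §2 proof of Thm. 1.2, (v)] -/
theorem deRosaProfile_apply_T_injective {c₀ T : ℝ} (hc₀ : c₀ ≠ 0) (hT : 0 < T) {μ μ' : ℝ}
    (h : (fun t => c₀ * (1 - 2 * μ * T * (1 - Real.exp (-t / (2 * T))))) T =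
      (fun t => c₀ * (1 - 2 * μ' * T * (1 - Real.exp (-t / (2 * T))))) T) : μ = μ' := by
  have hq : Real.exp (-T / (2 * T)) < 1 := by
    rw [Real.exp_lt_one_iff]
    exact div_neg_of_neg_of_pos (by linarith) (by positivity)
  have hne : (2 * T * (1 - Real.exp (-T / (2 * T)))) ≠ 0 :=
    mul_ne_zero (by positivity) (by linarith)
  have h1 : c₀ * (2 * T * (1 - Real.exp (-T / (2 * T)))) * μ =
      c₀ * (2 * T * (1 - Real.exp (-T / (2 * T)))) * μ' := by
    simp only at h
    linarith
  exact mul_left_cancel₀ (mul_ne_zero hc₀ hne) h1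

end Profiles

/-! ## Energy inequality on the slab from prescribed energy and bounded dissipation -/

section Energy

variable {α : ℝ}

/-- `ofReal (x / 2) = 2⁻¹ ofReal x`. [folklore] -/
theorem ofReal_div_two (x : ℝ) : ENNReal.ofReal (x / 2) = 2⁻¹ * ENNReal.ofReal x := by
  rw [div_eq_inv_mul, ENNReal.ofReal_mul (by norm_num : (0 : ℝ) ≤ 2⁻¹),
    ENNReal.ofReal_inv_of_pos (by norm_num : (0 : ℝ) < 2), ENNReal.ofReal_ofNat]

/-- **Dissipation of a Hölder slice under Cor. 7.2**: if `∫|(-Δ)^{α/2}f|² ≤ C₇[f]²_r` on `C^r`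
fields and `‖f‖_∞ + [f]_r ≤ B`, then `∫|(-Δ)^{α/2}f|² ≤ C₇B²`.
[cite: Derosa2018, §2 proof of Thm. 1.2 (the bound `(t-s)C_ε‖v‖²_{γ+ε}`)] -/
theorem eFracDissipation_le_of_cor72 {r : ℝ≥0} {C₇ B : ℝ} (hB : 0 ≤ B)
    (h7 : ∀ f : UnitAddTorus (Fin 3) → EuclideanSpace ℝ (Fin 3), MemHolder r f →
      Literature.Analysis.FluidPDE.Torus.eFracDissipation α f ≤ ENNReal.ofReal C₇ * eHolderNorm r f ^ 2)
    {f : UnitAddTorus (Fin 3) → EuclideanSpace ℝ (Fin 3)} (hf : MemHolder r f)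
    (hfB : Literature.Analysis.FunctionSpaces.eBoundedHolderNorm r f ≤ ENNReal.ofReal B) :
    Literature.Analysis.FluidPDE.Torus.eFracDissipation α f ≤ ENNReal.ofReal (C₇ * B ^ 2) := by
  have h1 : eHolderNorm r f ≤ ENNReal.ofReal B :=
    (Literature.Analysis.FunctionSpaces.eHolderNorm_le_eBoundedHolderNorm r f).trans hfB
  by_cases hC : 0 ≤ C₇
  · calc Literature.Analysis.FluidPDE.Torus.eFracDissipation α f
        ≤ ENNReal.ofReal C₇ * eHolderNorm r f ^ 2 := h7 f hf
      _ ≤ ENNReal.ofReal C₇ * ENNReal.ofReal B ^ 2 := by gcongr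
      _ = ENNReal.ofReal (C₇ * B ^ 2) := by
          rw [← ENNReal.ofReal_pow hB, ← ENNReal.ofReal_mul hC]
  · have h0 : ENNReal.ofReal C₇ = 0 := ENNReal.ofReal_of_nonpos (not_le.1 hC).le
    have := h7 f hf
    rw [h0, zero_mul, nonpos_iff_eq_zero] at this
    rw [this]
    exact bot_le

/-- **The energy inequality on `[0,T]` from a prescribed energy profile**: if the slices of `v`
are in `L²` with `∫‖v t‖² = e t` on `[0,T₀]`, the dissipation is bounded by `D` per unit time on
`[0,T₀]`, and the profile drops by at least `2D(t-s)` between `0 ≤ s < t ≤ T ≤ T₀`, then `v` obeys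
the energy inequality `½∫|v(t)|² + ∫ₛᵗ∫|(-Δ)^{α/2}v|² ≤ ½∫|v(s)|²` for all `0 ≤ s < t ≤ T`
(De Rosa: "`½(e(s) - e(t)) > ∫ₛᵗ∫|(-Δ)^{γ/2}v|²`", from `½(e(s)-e(t)) ≥ (K-1)(t-s)` and the
dissipation bound). [cite: Derosa2018, §2 proof of Thm. 1.2] -/
theorem fracEnergyIneq_of_profile {d : Type*} [Fintype d] [DecidableEq d]
    {v : ℝ → UnitAddTorus d → EuclideanSpace ℝ d} {e : ℝ → ℝ} {T T₀ D : ℝ} (hTT₀ : T ≤ T₀)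
    (hD : 0 ≤ D) (hL2 : ∀ t ∈ Icc 0 T₀, MemLp (v t) 2 volume)
    (he : ∀ t ∈ Icc 0 T₀, ∫ x, ‖v t x‖ ^ 2 = e t)
    (hdiss : ∀ t ∈ Icc 0 T₀, Literature.Analysis.FluidPDE.Torus.eFracDissipation α (v t) ≤ ENNReal.ofReal D)
    (hdec : ∀ s t, 0 ≤ s → s < t → t ≤ T → 2 * D * (t - s) ≤ e s - e t) :
    ∀ s t, 0 ≤ s → s < t → t ≤ T → Literature.Analysis.FluidPDE.Torus.FracEnergyIneq α v s t := by
  intro s t hs hst htT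
  have hsI : s ∈ Icc 0 T₀ := ⟨hs, (hst.le.trans htT).trans hTT₀⟩
  have htI : t ∈ Icc 0 T₀ := ⟨hs.trans hst.le, htT.trans hTT₀⟩
  have hEq : ∀ τ ∈ Icc 0 T₀, Literature.Analysis.FluidPDE.Torus.eL2NormSq (v τ) = ENNReal.ofReal (e τ) := by
    intro τ hτ
    rw [Literature.Analysis.FluidPDE.Torus.eL2NormSq,
      Literature.Analysis.FluidPDE.Torus.lintegral_enorm_sq_eq_ofReal (hL2 τ hτ), he τ hτ]
  have he_nn : ∀ τ ∈ Icc 0 T₀, 0 ≤ e τ := fun τ hτ => by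
    rw [← he τ hτ]
    exact integral_nonneg fun x => by positivity
  -- dissipation over `(s,t)`
  have hDint : ∫⁻ τ in Ioo s t, Literature.Analysis.FluidPDE.Torus.eFracDissipation α (v τ) ≤
      ENNReal.ofReal (D * (t - s)) := by
    calc ∫⁻ τ in Ioo s t, Literature.Analysis.FluidPDE.Torus.eFracDissipation α (v τ)
        ≤ ∫⁻ _ in Ioo s t, ENNReal.ofReal D :=
          setLIntegral_mono' measurableSet_Ioo fun τ hτ =>
            hdiss τ ⟨hs.trans hτ.1.le, (hτ.2.le.trans htT).trans hTT₀⟩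
      _ = ENNReal.ofReal D * volume (Ioo s t) := setLIntegral_const _ _
      _ = ENNReal.ofReal (D * (t - s)) := by
          rw [Real.volume_Ioo, ← ENNReal.ofReal_mul hD]
  unfold Literature.Analysis.FluidPDE.Torus.FracEnergyIneq
  rw [hEq t htI, hEq s hsI, ← ofReal_div_two, ← ofReal_div_two]
  calc ENNReal.ofReal (e t / 2) + ∫⁻ τ in Ioo s t, Literature.Analysis.FluidPDE.Torus.eFracDissipation α (v τ)
      ≤ ENNReal.ofReal (e t / 2) + ENNReal.ofReal (D * (t - s)) := add_le_add le_rfl hDint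
    _ = ENNReal.ofReal (e t / 2 + D * (t - s)) := by
        rw [← ENNReal.ofReal_add (by linarith [he_nn t htI]) (by nlinarith)]
    _ ≤ ENNReal.ofReal (e s / 2) := by
        refine ENNReal.ofReal_le_ofReal ?_
        have := hdec s t hs hst htT
        linarith

end Energy

end Literature.Analysis.FluidPDE
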